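import Summits.QuantumFields.YangMills.Theorems.UnitScaleTiltProp8HalvingQuarterMatrix
import HarnessLib

/-!
# Route `UnitScaleTilt`, crux K1 child «MinimiserStabilityRegPr» (stmt-QuantumFields-19200), registered stub V2′ `stub_halvingStep`
# (skeletons v8 5b4e846794b80374 / v10 `BirthV10`) — **THE P2 LETTERS OF `H` ON SUP-SIZED `𝔤`-VALUED DATA, WITHOUT COMPONENT LOSS**: for data of size
# `‖X(c)‖ ≤ t·L^{k−j(c)}` at EVERY index bond (print's normalisation: `(L^{j(c)}η)|X_print(c)| ≤ t`, no near/far split, no (163)) the kernel extension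
# `ℌX(b) = Σ_c (He_c)(b)·X(c)` of the P2 operator `H` obeys, at every bond of the top cube, `‖ℌX(b)‖, Lᵏ‖ℌX(b+e_κ) − ℌX(b)‖, ‖(∂^{η*}∂^ηℌX♯)_μ(z)‖ ≤ B₀B₃·t` — the
# three (1.140) letters of the `(157)-R` clause of the interior package (`HalvingAssemblyInterior`) when `R = HD(A′)` is built with the P2 operator on the chart
# remainder `D(A′)` of un-weighted size `C₂r²` (P3a `Prop8Chart.ChartRemainderAt` (hCq)): `K₂ε₀² := B₀B₃C₂r²`

Cell `ym3-torus` (HUMAN RULING D-0037, YM ladder rung R3 — continuum SU(2) YM₃ on the torus is a RUNG, not the Clay problem), width seat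
`ym-ust-19200-w3` gen 2 (D-0149).  `--supports stmt-QuantumFields-19200 --as helper`; def-free, 0 sorry, standard axioms.  Pattern of `HalvingQuarterMatrix` (p593496):
w3 g0's real rows `FlatHBBound164.rows164_of_hDecayLetterD` for every norm-dominated reading + duality + the flat stencil dictionary.

THE PRINT ([Balaban1985Variational] p. 303 (161)–(162), p. 304 (165)): the kernel bound `|HB(b)| ≤ B₀Σ_c e^{−δ₀d(b,c)}(L^{j(c)}η)⁻¹|B(c)|` and the row sum
`Σ_c e^{−½δ₀d}(d + 1)(L^{j(c)}η)⁻¹ ≤ B₃∕(…)` bound `H` on data measured in the weighted sup norm — the third summand `B₀4C₂(36dL²B₁Mε₀)²` of (165) is this letter on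
the chart remainder.

WHAT THIS FILE PROVES (no definition, no sorry):
* §1 **`rowsSup_real`** — the four REAL rows of `HDecayLetterD`∕`RowSum162` (any `D`, `dBI ≥ 0`, `w₁(b) ≥ 0`) for data `|X(c)| ≤ t·L^{k−j(c)}`: `≤ B₀B₃t`
  (`e^{−δ₀d} ≤ e^{−½δ₀d}·(d + 1)`; `FlatHBBound164.rows164_of_hDecayLetterD`).
* §2 **`matrixRowsSup`** — the same for the `𝔤`-valued kernel extension `ℌX` at a bond where the P2 weights are `1` (the top cube): the `h1`∕`h2`∕`h3` letters
  `‖ℌX(b)‖`, `Lᵏ‖ℌX(⟨b₋+e_κ, dir b⟩) − ℌX(b)‖`, `‖pdiv η 1 (plaqCovDeriv η 1 (pull ℌX 0)) μ z‖` (`b = ⟨0 + z, μ⟩`) are `≤ B₀B₃t`.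
HONEST SCOPE: bookkeeping over P2's letters (✓ `FlatPortBodyL0.body_of_adm22` for odd `L ≥ 5` on big tori); which `H` builds print's `HD(A′)` (P2's `flatH` or P3a's
gauge-corrected right inverse, vet junction G3) is the P5 assembler's choice — this file serves the `flatH` choice.  NOT a claim about the crux, the rung, or the mass gap.

References: T. Bałaban, CMP **102** (1985) 277–309 [Balaban1985Variational] (157) p.302, (161)–(162) p.303, (165) p.304; CMP **96** (1984) 223–250
[Balaban1984PropagatorsII] Cor. 2.8 (2.150)–(2.151) p.249; CMP **99** (1985) 75–102 [Balaban1985RegularSpaces] (1.140) p.100.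
-/

set_option autoImplicit false

noncomputable section

open scoped BigOperators Matrix.Norms.L2Operator

namespace Summit.QuantumFields.YangMills.Theorems.HalvingHMatrixSup

open Literature.MathematicalPhysics.QuantumFieldTheory.Balaban1983to89
open B6SectADomainsV1 (Domains)
open B6SectAOperatorsV1 (BondIdx dcE dcsE)
open B8Eq143PlaqExpansion (pdiv)
open B8Eq146AExpansion (plaqCovDeriv)
open B10Eq27TorusAxialLog (pull transl)
open T3ContinuumYM3Torus (T3Family)
open FlatCubeOpsText (HDecayLetterD RowSum162)
open HalvingQuarterMatrix (norm_le_of_forall_reFunctional re_pdiv_plaqCovDeriv_pull reFunctional_kernel)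

/-! ## §1 The real rows for sup-sized data -/

section Real

variable {F : T3Family} {n K : ℕ} {D : Domains (F.P K)}

/-- **THE FOUR REAL ROWS OF `H` FOR SUP-SIZED DATA**: `HDecayLetterD` ∧ `RowSum162` over a nonnegative `dBI`, `0 ≤ δ₀, B₀, t`, `0 ≤ w₁(b)`, and `|X(c)| ≤ t·L^{k−j(c)}`
at every index bond ⟹ the four left-weighted rows at `b` are `≤ B₀B₃t`. [cite: Balaban1985Variational, (161)-(162) p.303, (165) p.304] -/
theorem rowsSup_real {dBI : PBond (F.P K) 0 → BondIdx D → ℝ} {w : ℕ → PBond (F.P K) 0 → ℝ} {H : (BondIdx D → ℝ) →ₗ[ℝ] (PBond (F.P K) 0 → ℝ)}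
    {δ₀ B₀ B₃ t : ℝ} (hH : HDecayLetterD F n K D dBI w H B₀ δ₀) (h162 : RowSum162 F n K D dBI w δ₀ B₃) (hδ₀ : 0 ≤ δ₀) (hB₀ : 0 ≤ B₀)
    (ht : 0 ≤ t) {b : PBond (F.P K) 0} (hd : ∀ c, 0 ≤ dBI b c) (hwb : 0 ≤ w 1 b) {X : BondIdx D → ℝ}
    (hX : ∀ c : BondIdx D, |X c| ≤ t * (F.L : ℝ) ^ ((K - n) - (c.1.1 : ℕ))) :
    w 1 b * (w 1 b * |H X b|) ≤ B₀ * B₃ * t ∧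
    (∀ ν : Fin 3, w 1 b * (w 2 b * (F.L : ℝ) ^ (K - n) * |H X ⟨b.src.shift ν, b.dir⟩ - H X b|) ≤ B₀ * B₃ * t) ∧
    w 1 b * (w 3 b * |(dcsE ((F.L : ℝ) ^ (K - n)) (dcE ((F.L : ℝ) ^ (K - n)) (WithLp.toLp 2 (H X)))) b|) ≤ B₀ * B₃ * t ∧
    w 1 b * (w 3 b * ((F.L : ℝ) ^ (K - n)) ^ 2 *
        |∑ ν : Fin 3, ((H X b - H X ⟨b.src.shift ν, b.dir⟩) + (H X b - H X ⟨b.src.unshift ν, b.dir⟩))|) ≤ B₀ * B₃ * t := by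
  -- the effective-datum bound with `β = t`: `e^{−½δ₀d} ≤ 1 ≤ d + 1`
  have hXeff : ∀ c : BondIdx D, Real.exp (-(δ₀ / 2 * dBI b c)) * |X c| ≤ t * ((dBI b c + 1) * (F.L : ℝ) ^ ((K - n) - (c.1.1 : ℕ))) := by
    intro c
    have hexp : Real.exp (-(δ₀ / 2 * dBI b c)) ≤ 1 := by rw [Real.exp_le_one_iff]; nlinarith [hd c]
    have hL0 : (0 : ℝ) ≤ (F.L : ℝ) ^ ((K - n) - (c.1.1 : ℕ)) := by positivity
    calc Real.exp (-(δ₀ / 2 * dBI b c)) * |X c| ≤ 1 * |X c| := mul_le_mul_of_nonneg_right hexp (abs_nonneg _)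
      _ ≤ t * (1 * (F.L : ℝ) ^ ((K - n) - (c.1.1 : ℕ))) := by rw [one_mul, one_mul]; exact hX c
      _ ≤ t * ((dBI b c + 1) * (F.L : ℝ) ^ ((K - n) - (c.1.1 : ℕ))) :=
          mul_le_mul_of_nonneg_left (mul_le_mul_of_nonneg_right (by linarith [hd c]) hL0) ht
  exact FlatHBBound164.rows164_of_hDecayLetterD hH h162 hB₀ ht hwb hXeff

end Real

/-! ## §2 The `𝔤`-valued kernel extension at a bond of the top cube -/

section Matrix

variable {F : T3Family} {n K : ℕ} {D : Domains (F.P K)}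

/-- **THE THREE (1.140) LETTERS OF `ℌX` FOR SUP-SIZED `𝔤`-VALUED DATA** at a bond `b` where the P2 weights are `1` (`w m b = 1`, the top cube): for
`ℌX(b′) = Σ_c (He_c)(b′)·X(c)` and `‖X(c)‖ ≤ t·L^{k−j(c)}` at every index bond: `‖ℌX(b)‖ ≤ B₀B₃t`, `Lᵏ‖ℌX(⟨b₋ + e_κ, dir b⟩) − ℌX(b)‖ ≤ B₀B₃t`, and, when
`b = ⟨0 + z, μ⟩`, `‖(∂^{η*}∂^ηℌX♯)_μ(z)‖ ≤ B₀B₃t` (`η = L^{−k}`). [cite: Balaban1985Variational, (157) p.302, (161)-(162) p.303, (165) p.304; Balaban1985RegularSpaces, (1.140) p.100] -/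
theorem matrixRowsSup {dBI : PBond (F.P K) 0 → BondIdx D → ℝ} {w : ℕ → PBond (F.P K) 0 → ℝ} {H : (BondIdx D → ℝ) →ₗ[ℝ] (PBond (F.P K) 0 → ℝ)}
    {δ₀ B₀ B₃ t : ℝ} (hH : HDecayLetterD F n K D dBI w H B₀ δ₀) (h162 : RowSum162 F n K D dBI w δ₀ B₃) (hδ₀ : 0 ≤ δ₀) (hB₀ : 0 ≤ B₀) (hB₃ : 0 ≤ B₃)
    (ht : 0 ≤ t) {b : PBond (F.P K) 0} (hd : ∀ c, 0 ≤ dBI b c) (hwb : ∀ m, w m b = 1)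
    {X : BondIdx D → Matrix (Fin 2) (Fin 2) ℂ} {𝔄 : PBond (F.P K) 0 → Matrix (Fin 2) (Fin 2) ℂ}
    (h𝔄 : ∀ b', 𝔄 b' = ∑ c, H (Pi.single c 1) b' • X c)
    (hX : ∀ c : BondIdx D, ‖X c‖ ≤ t * (F.L : ℝ) ^ ((K - n) - (c.1.1 : ℕ))) :
    ‖𝔄 b‖ ≤ B₀ * B₃ * t ∧
    (∀ κ : Fin 3, (F.L : ℝ) ^ (K - n) * ‖𝔄 ⟨b.src.shift κ, b.dir⟩ - 𝔄 b‖ ≤ B₀ * B₃ * t) ∧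
    ∀ (z : B7Prop1Explicit.Site (F.P K).d) (μ : Fin (F.P K).d), b = ⟨transl 0 z, μ⟩ →
      ‖pdiv (((F.L : ℝ)⁻¹) ^ (K - n)) (1 : B7Prop1Explicit.Site (F.P K).d → Fin (F.P K).d → (Matrix (Fin 2) (Fin 2) ℂ)ˣ)
          (plaqCovDeriv (((F.L : ℝ)⁻¹) ^ (K - n)) (1 : B7Prop1Explicit.Site (F.P K).d → Fin (F.P K).d → (Matrix (Fin 2) (Fin 2) ℂ)ˣ)
            (pull 𝔄 0)) μ z‖ ≤ B₀ * B₃ * t := by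
  set q : ℝ := B₀ * B₃ * t with hq
  have hq0 : 0 ≤ q := by positivity
  have hLk : (0 : ℝ) < (F.L : ℝ) ^ (K - n) := by
    have : (0 : ℝ) < (F.L : ℝ) := by exact_mod_cast lt_trans zero_lt_one F.hL.2
    positivity
  -- the real rows for every norm-dominated reading, weights evaluated to `1`
  have key : ∀ (f : StrongDual ℂ (Matrix (Fin 2) (Fin 2) ℂ)) (u : ℂ) (r : ℝ),
      (∀ y : Matrix (Fin 2) (Fin 2) ℂ, |r * (u * f y).re| ≤ ‖y‖) →
      |H (fun c => r * (u * f (X c)).re) b| ≤ q ∧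
      (∀ ν : Fin 3, (F.L : ℝ) ^ (K - n) * |H (fun c => r * (u * f (X c)).re) ⟨b.src.shift ν, b.dir⟩ - H (fun c => r * (u * f (X c)).re) b| ≤ q) ∧
      |(dcsE ((F.L : ℝ) ^ (K - n)) (dcE ((F.L : ℝ) ^ (K - n)) (WithLp.toLp 2 (H (fun c => r * (u * f (X c)).re))))) b| ≤ q := by
    intro f u r hg
    obtain ⟨r1, r2, r3, -⟩ := rowsSup_real hH h162 hδ₀ hB₀ ht hd (by rw [hwb 1]; exact zero_le_one) (X := fun c => r * (u * f (X c)).re)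
      (fun c => (hg (X c)).trans (hX c))
    rw [hwb 1] at r1 r2 r3
    rw [hwb 2] at r2
    rw [hwb 3] at r3
    exact ⟨by simpa using r1, fun ν => by simpa using r2 ν, by simpa using r3⟩
  refine ⟨?_, fun κ => ?_, fun z μ hbz => ?_⟩
  · refine norm_le_of_forall_reFunctional (𝔄 b) hq0 fun f u r hg => ?_
    rw [reFunctional_kernel H h𝔄 f u r b]
    exact le_of_abs_le (key f u r hg).1
  · have hdiff : ‖𝔄 ⟨b.src.shift κ, b.dir⟩ - 𝔄 b‖ ≤ q / (F.L : ℝ) ^ (K - n) := by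
      refine norm_le_of_forall_reFunctional _ (div_nonneg hq0 hLk.le) fun f u r hg => ?_
      have hlin : r * (u * f (𝔄 ⟨b.src.shift κ, b.dir⟩ - 𝔄 b)).re =
          H (fun c => r * (u * f (X c)).re) ⟨b.src.shift κ, b.dir⟩ - H (fun c => r * (u * f (X c)).re) b := by
        rw [map_sub, mul_sub, Complex.sub_re, mul_sub, reFunctional_kernel H h𝔄 f u r, reFunctional_kernel H h𝔄 f u r]
      have h2 := (key f u r hg).2.1 κ
      have habs : |H (fun c => r * (u * f (X c)).re) ⟨b.src.shift κ, b.dir⟩ - H (fun c => r * (u * f (X c)).re) b| ≤ q / (F.L : ℝ) ^ (K - n) := by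
        rw [le_div_iff₀ hLk, mul_comm]
        exact h2
      rw [hlin]
      exact (le_abs_self _).trans habs
    calc (F.L : ℝ) ^ (K - n) * ‖𝔄 ⟨b.src.shift κ, b.dir⟩ - 𝔄 b‖ ≤ (F.L : ℝ) ^ (K - n) * (q / (F.L : ℝ) ^ (K - n)) :=
          mul_le_mul_of_nonneg_left hdiff hLk.le
      _ = q := mul_div_cancel₀ q hLk.ne'
  · refine norm_le_of_forall_reFunctional _ hq0 fun f u r hg => ?_
    rw [re_pdiv_plaqCovDeriv_pull]
    have hfun : (fun b' : PBond (F.P K) 0 => r * (u * f (𝔄 b')).re) = H (fun c => r * (u * f (X c)).re) :=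
      funext fun b' => reFunctional_kernel H h𝔄 f u r b'
    have hη : ((((F.L : ℝ)⁻¹) ^ (K - n))⁻¹ : ℝ) = (F.L : ℝ) ^ (K - n) := by rw [inv_pow, inv_inv]
    rw [hfun, hη, ← hbz]
    exact le_of_abs_le (key f u r hg).2.2

end Matrix

end Summit.QuantumFields.YangMills.Theorems.HalvingHMatrixSup

end
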